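import Summits.BirchSwinnertonDyer.BirchSwinnertonDyer.Theses.PrintX8
import HarnessLib

/-!
# Route `PrintX8` — the Assembly item (stmt-BirchSwinnertonDyer-20314) PROVED: C1 → C2 → C3 → GZK →
# the X8 leaf `WAllCornerX8` (cell `bsd-print-x8`, seat p1; pure logic + one tree theorem)

PARTITION (D-0054(2)): corner X8 = K3 row A8 (`CornersAll` §1b; W-ALL row 8 `WAllCornerX8`); proves
the route's JOIN — nothing arithmetic; closes the Assembly item only; 0 census cells move; BSD is not
proved by any of this. Beyond-print theorem: no.

The route `PrintX8` (planner `bsd-print-x8-plan`, rev 0, 2026-08-27T13:05Z) reads the leaf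
`Summit.BirchSwinnertonDyer.WAllCornerX8 := ∀ W p, ¬CM → ClassX8 W p → r_an ≤ 1 → BSDp W p` from
three cruxes and one support: C1 `SharpFlatMainConjectureX8` (the ONE residual: Sprung's ♯/♭ main
conjecture at every X8 pair of analytic rank `≤ 1`, both colours), C2 `SharpFlatRankOneLinkX8` (rank
one: main conjecture ⟹ `MissingPPartAt`, Burungale–Kobayashi–Ota Cor. A.5 by name), C3
`SharpFlatRankZeroLinkX8` (rank zero: main conjecture ⟹ `MissingPPartAt`, Sprung 2024 §5.2 by name),
and `RankEqAnalyticRankLeOne` (GZK by name). This file proves the item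
`Assembly := C1 → C2 → C3 → GZK → WAllCornerX8` exactly as the planner's sketch says: fix the pair,
split `r_an ≤ 1` into `0 ∨ 1` (`Nat.le_one_iff_eq_zero_or_eq_one`), apply the link of that rank to
C1's main conjecture, and turn `MissingPPartAt W p` into Miller's `BSDp W p` by the tree theorem
`Rank1Residual.Typed.bsdp_of_missingPPartAt` with GZK. The `¬CM` binder of the leaf is not used
(X8 ∩ CM = ∅: a CM curve supersingular at `3` has `a_3 = 0`).

References: route file `Theses/PrintX8.lean` (items 20304, 20305, 20313, 19921, 20314);
[Miller2011LMS] Def. 1.1; [Sprung2024] §5; [BurungaleKobayashiOta2023] App. A Cor. A.5.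
-/

set_option autoImplicit false
-- justification: the mandated namespace `Summit.BirchSwinnertonDyer.BirchSwinnertonDyer.Theorems`
-- (single-conjunct summit, Sub = Summit) repeats a segment by design (D-0017).
set_option linter.dupNamespace false

namespace Summit.BirchSwinnertonDyer.BirchSwinnertonDyer.Theorems.PrintX8Assembly

open Literature.NumberTheory.EllipticCurves Literature.NumberTheory.EllipticCurves.Rank1Residual
  Literature.NumberTheory.EllipticCurves.Rank1Residual.Typed
  Summit.BirchSwinnertonDyer.BirchSwinnertonDyer.Theses.PrintX8

/-- **Route `PrintX8`, Assembly item (stmt-BirchSwinnertonDyer-20314): `C1 → C2 → C3 → GZK → WAllCornerX8`.**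
Given an X8 pair `(W, p)` (`p = 3`, good supersingular, `a_3 = ±3`) of analytic rank `≤ 1`: C1 gives
Sprung's ♯/♭ main conjecture at the pair for both colours; by `Nat.le_one_iff_eq_zero_or_eq_one` the
analytic rank is `0` or `1`; C3 (rank `0`) resp. C2 (rank `1`) turns the main conjecture into the typed
output `MissingPPartAt W p`; `Typed.bsdp_of_missingPPartAt` with Gross–Zagier–Kolyvagin (the support
item, by name) gives Miller's `BSDp W p`. Pure logic plus that one tree theorem; the leaf's `¬CM`
binder is unused. [cite: Miller2011LMS, §1 and Def. 1.1] -/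
theorem assembly_holds : Assembly := by
  unfold Assembly SharpFlatMainConjectureX8 SharpFlatRankOneLinkX8 SharpFlatRankZeroLinkX8
    RankEqAnalyticRankLeOne Summit.BirchSwinnertonDyer.WAllCornerX8
  intro h1 h2 h3 hGZK W _ _ p _ _ hX hr
  have hMC := h1 W p hX hr
  rcases Nat.le_one_iff_eq_zero_or_eq_one.mp hr with h0 | h1'
  · exact bsdp_of_missingPPartAt W p hGZK hr (h3 W p hX h0 hMC)
  · exact bsdp_of_missingPPartAt W p hGZK hr (h2 W p hX h1' hMC)

/-- The deciding theorem of route `PrintX8` restated with the Assembly item DISCHARGED: the three cruxes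
and GZK by name give the X8 leaf `WAllCornerX8` (= `Theses.PrintX8.closes assembly_holds`).
[cite: Miller2011LMS, §1 and Def. 1.1] -/
theorem wAllCornerX8_of_cruxes (h1 : SharpFlatMainConjectureX8) (h2 : SharpFlatRankOneLinkX8)
    (h3 : SharpFlatRankZeroLinkX8) (hGZK : RankEqAnalyticRankLeOne) :
    Summit.BirchSwinnertonDyer.WAllCornerX8 :=
  -- buildfix (bf3-g26): route `PrintX8` rev 2 re-cut `closes` to eight hypotheses (K1/small-image/published
  -- inputs/glue items); this corollary needs only the proved `Assembly`, whose four hypotheses are exactly ours.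
  assembly_holds h1 h2 h3 hGZK

end Summit.BirchSwinnertonDyer.BirchSwinnertonDyer.Theorems.PrintX8Assembly
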